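import Literature.Topology.FourManifolds.CircleFramingSplice
import Literature.Topology.FourManifolds.SmoothOrientationProofs
import Literature.Topology.FourManifolds.SmoothOrientationDiffeomorphProofs
import Mathlib.Geometry.Manifold.ContMDiff.Atlas
import Mathlib.Geometry.Manifold.ContMDiff.NormedSpace
import Mathlib.Analysis.Calculus.ContDiff.Deriv
import Mathlib.Analysis.Calculus.Deriv.Comp
import HarnessLib

/-!
# Walking a frame along a curve, chart by chart; coherence of a smooth orientation on a chart

Topic `Literature/Topology/FourManifolds`; second of the three files discharging
`Literature.Topology.FourManifolds.exists_normalFraming_of_isOrientable` (overview in `CircleFramingSplice.lean`).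
The manifold `X` is charted on its model vector space `E` (model `𝓘(ℝ, E)`, the case of
`ChartedSpace (EuclideanSpace ℝ (Fin 4)) X`, model `𝓡 4`), and `γ : ℝ → X` is a smooth curve.

* **Curves in charts.** `CircleFraming.chartVec E γ p t` is the velocity `(φ_p ∘ γ)'(t)` read in
  the extended chart at `p`; it is smooth on `γ ⁻¹' (chart domain)` (`contDiffOn_chartVec`),
  transforms through the derivative cocycle `tangentCoordChange` of the chart changes
  (`chartVec_eq_tangentCoordChange`, chain rule), and the cocycle is smooth along the curve
  (`contDiffOn_tangentCoordChange_comp`, from Mathlib's `contDiffOn_fderiv_coord_change`) and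
  bijective on overlaps (`bijective_tangentCoordChange`).
* **Orientations.** For a smooth orientation `o` (`Literature.Topology.FourManifolds.SmoothOrientation`: an
  orientation of the model space at every point, read in the preferred chart there, such that
  near `x`, `o y = o x` iff the chart change `y → x` has positive Jacobian), the local-constancy
  axiom propagates along the connected component of `p` in its chart domain:
  `CircleFraming.orientation_apply_eq_iff_of_mem_connectedComponentIn` (`o x = o p` iff the chart
  change `x → p` has positive Jacobian at `x`, clopen argument) and, between two chart centres,
  `CircleFraming.orientation_det_tangentCoordChange_pos_iff` (the chart change `p → p'` has positive
  Jacobian at such an `x` iff `o p' = o p`). This is Hirsch's propagation of orientations along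
  paths (*Differential Topology* (1976), Ch. 4 §4, paragraph preceding Lemma 4.1: *"a given
  orientation of a single fibre extends to a unique orientation by propagation along paths"*) in
  the chart language of `SmoothOrientation`.
* **Frame fields along `γ`.** A frame field is `Nf : ℝ → F →L[ℝ] E`, the value `Nf t` read in the
  preferred chart at `γ t` (as Mathlib reads tangent vectors); `CircleFraming.SmoothFrameOn γ Nf s`
  (chartwise smoothness: re-read in any fixed chart it is smooth in `t`), `CircleFraming.FrameAt`
  (`Nf t` completes the velocity at `t`), the representation lemma `smoothFrameOn_of_eq` and the
  validity transfer `frameAt_iff_of_eq`.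
* **The walk.** `CircleFraming.walk_step` (one segment) and `CircleFraming.exists_walkInv_one`: along
  a smooth curve with nonvanishing chart velocities in `X` with `dim E = dim F + 1`, a frame `M₀`
  of the velocity at `0` extends to a frame field, chartwise smooth on a neighbourhood of
  `[0, 1]`, consisting of frames on `[0, 1]`, equal to the constant `M₀` (read from the chart at
  `p₀ ∋ γ 0`) near `0`, and constant in some chart near `1` (`CircleFraming.WalkInv`). This is the
  elementary half of Hirsch, Ch. 4 §4, Exercise 2 (bundles over an interval are trivial; over
  the circle the only obstruction is the orientation character of the loop, handled in
  `NormalFramingOfCircle.lean`). Construction: by the Lebesgue number lemma cut `[0, 1]` into finitely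
  many segments on each of which `γ` stays in one chart with velocity at a positive angle from a
  reference velocity `S`; on each segment splice (`CircleFraming.exists_splice`) the incoming frame
  germ to the constant frame obtained by shearing its columns along the current velocity into
  `S^⊥` (`CircleFraming.shearProj`), which completes every velocity of the segment. No partition of
  unity and no Riemannian structure on `X` are used.

Everything is proved; no named facts are introduced.

## References

* M. W. Hirsch, *Differential Topology*, GTM 33, Springer (1976), Ch. 4 §4, paragraphs around
  Lemma 4.1 (orientations as coherent families; propagation along paths), and Exercise 2 (p. 108).
  [HirschDT1976]
-/

open Set Function Filter
open scoped Manifold Topology ContDiff RealInnerProductSpace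

noncomputable section

namespace Literature.Topology.FourManifolds.CircleFraming

section Curve

variable {E : Type*} [NormedAddCommGroup E] [NormedSpace ℝ E] {X : Type*} [TopologicalSpace X]
  [ChartedSpace E X] {γ : ℝ → X}

variable (E) in
/-- **The velocity of a curve read in a chart**: `chartVec E γ p t` is the derivative at `t` of
`γ` read in the extended chart at `p` (meaningful when `γ t` lies in the chart domain of `p`).
[folklore] -/
def chartVec (γ : ℝ → X) (p : X) (t : ℝ) : E := deriv (extChartAt 𝓘(ℝ, E) p ∘ γ) t

omit [NormedSpace ℝ E] in
/-- The preimage of a chart domain under a continuous curve is open. [folklore] -/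
theorem isOpen_preimage_source (hγ : Continuous γ) (p : X) :
    IsOpen (γ ⁻¹' (chartAt E p).source) :=
  (chartAt E p).open_source.preimage hγ

variable [IsManifold 𝓘(ℝ, E) ∞ X]

/-- A smooth curve read in a chart is smooth on the preimage of the chart domain. [folklore] -/
theorem contDiffOn_extChartAt_comp (hγ : ContMDiff 𝓘(ℝ, ℝ) 𝓘(ℝ, E) ∞ γ) (p : X) :
    ContDiffOn ℝ ∞ (extChartAt 𝓘(ℝ, E) p ∘ γ) (γ ⁻¹' (chartAt E p).source) :=
  contMDiffOn_iff_contDiffOn.1 (contMDiffOn_extChartAt.comp hγ.contMDiffOn fun _ ht => ht)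

/-- The chart velocity of a smooth curve is smooth on the preimage of the chart domain.
[folklore] -/
theorem contDiffOn_chartVec (hγ : ContMDiff 𝓘(ℝ, ℝ) 𝓘(ℝ, E) ∞ γ) (p : X) :
    ContDiffOn ℝ ∞ (chartVec E γ p) (γ ⁻¹' (chartAt E p).source) :=
  (contDiffOn_extChartAt_comp hγ p).deriv_of_isOpen
    (isOpen_preimage_source (E := E) hγ.continuous p) le_rfl

/-- The chart velocity of a smooth curve is continuous on the preimage of the chart domain.
[folklore] -/
theorem continuousOn_chartVec (hγ : ContMDiff 𝓘(ℝ, ℝ) 𝓘(ℝ, E) ∞ γ) (p : X) :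
    ContinuousOn (chartVec E γ p) (γ ⁻¹' (chartAt E p).source) :=
  (contDiffOn_chartVec hγ p).continuousOn

/-- A smooth curve read in a chart has its chart velocity as derivative. [folklore] -/
theorem hasDerivAt_extChartAt_comp (hγ : ContMDiff 𝓘(ℝ, ℝ) 𝓘(ℝ, E) ∞ γ) {p : X} {t : ℝ}
    (ht : γ t ∈ (chartAt E p).source) :
    HasDerivAt (extChartAt 𝓘(ℝ, E) p ∘ γ) (chartVec E γ p t) t :=
  (((contDiffOn_extChartAt_comp hγ p).differentiableOn (by simp)).differentiableAt
    ((isOpen_preimage_source (E := E) hγ.continuous p).mem_nhds ht)).hasDerivAt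

/-- **Change of chart for the chart velocity**: on the overlap of two chart domains the chart
velocities differ by the derivative of the chart change. [folklore] -/
theorem chartVec_eq_tangentCoordChange (hγ : ContMDiff 𝓘(ℝ, ℝ) 𝓘(ℝ, E) ∞ γ) {p q : X} {t : ℝ}
    (hp : γ t ∈ (chartAt E p).source) (hq : γ t ∈ (chartAt E q).source) :
    chartVec E γ q t = tangentCoordChange 𝓘(ℝ, E) p q (γ t) (chartVec E γ p t) := by
  have hp' : γ t ∈ (extChartAt 𝓘(ℝ, E) p).source := by rwa [extChartAt_source]
  have hq' : γ t ∈ (extChartAt 𝓘(ℝ, E) q).source := by rwa [extChartAt_source]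
  -- derivative of the chart change
  have hT : HasFDerivAt (extChartAt 𝓘(ℝ, E) q ∘ (extChartAt 𝓘(ℝ, E) p).symm)
      (tangentCoordChange 𝓘(ℝ, E) p q (γ t)) (extChartAt 𝓘(ℝ, E) p (γ t)) := by
    have h := hasFDerivWithinAt_tangentCoordChange (I := 𝓘(ℝ, E)) (x := p) (y := q) (z := γ t)
      ⟨hp', hq'⟩
    rwa [modelWithCornersSelf_coe, range_id, hasFDerivWithinAt_univ] at h
  have hcomp := hT.comp_hasDerivAt t (hasDerivAt_extChartAt_comp hγ hp)
  -- near `t` the chart-`q` reading is the composite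
  have hev : extChartAt 𝓘(ℝ, E) q ∘ γ =ᶠ[𝓝 t]
      (extChartAt 𝓘(ℝ, E) q ∘ (extChartAt 𝓘(ℝ, E) p).symm) ∘ (extChartAt 𝓘(ℝ, E) p ∘ γ) := by
    filter_upwards [(isOpen_preimage_source (E := E) hγ.continuous p).mem_nhds hp] with s hs
    have hs' : γ s ∈ (extChartAt 𝓘(ℝ, E) p).source := by rwa [extChartAt_source]
    simp only [comp_apply, (extChartAt 𝓘(ℝ, E) p).left_inv hs']
  rw [chartVec, hev.deriv_eq]
  exact hcomp.deriv

/-- **The derivative of the chart change is smooth along a smooth curve** (on the preimage of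
the overlap of the two chart domains). [folklore] -/
theorem contDiffOn_tangentCoordChange_comp (hγ : ContMDiff 𝓘(ℝ, ℝ) 𝓘(ℝ, E) ∞ γ) (p q : X) :
    ContDiffOn ℝ ∞ (fun t => tangentCoordChange 𝓘(ℝ, E) p q (γ t))
      (γ ⁻¹' ((chartAt E p).source ∩ (chartAt E q).source)) := by
  have : IsManifold 𝓘(ℝ, E) (∞ + 1) X := ‹IsManifold 𝓘(ℝ, E) ∞ X›
  have h1 := contDiffOn_fderiv_coord_change (I := 𝓘(ℝ, E)) (n := ∞) (achart E p) (achart E q)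
  have h2 : ContDiffOn ℝ ∞ (extChartAt 𝓘(ℝ, E) p ∘ γ)
      (γ ⁻¹' ((chartAt E p).source ∩ (chartAt E q).source)) :=
    (contDiffOn_extChartAt_comp hγ p).mono (preimage_mono inter_subset_left)
  refine (h1.comp h2 fun t ht => ?_).congr fun t ht => rfl
  have ht' : γ t ∈ (chartAt E p).source ∩ (chartAt E q).source := ht
  have hp' : γ t ∈ (extChartAt 𝓘(ℝ, E) p).source := by rw [extChartAt_source]; exact ht'.1
  change extChartAt 𝓘(ℝ, E) p (γ t) ∈
    ((extChartAt 𝓘(ℝ, E) p).symm ≫ extChartAt 𝓘(ℝ, E) q).source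
  rw [PartialEquiv.trans_source, mem_inter_iff, PartialEquiv.symm_source, mem_preimage,
    (extChartAt 𝓘(ℝ, E) p).left_inv hp', extChartAt_source]
  exact ⟨(extChartAt 𝓘(ℝ, E) p).map_source hp', ht'.2⟩

omit [IsManifold 𝓘(ℝ, E) ∞ X] in
/-- The derivative of the chart change is continuous along a continuous curve. [folklore] -/
theorem continuousOn_tangentCoordChange_comp [IsManifold 𝓘(ℝ, E) 1 X] (hγ : Continuous γ)
    (p q : X) : ContinuousOn (fun t => tangentCoordChange 𝓘(ℝ, E) p q (γ t))
      (γ ⁻¹' ((chartAt E p).source ∩ (chartAt E q).source)) := by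
  refine (continuousOn_tangentCoordChange p q).comp hγ.continuousOn fun t ht => ?_
  have ht' : γ t ∈ (chartAt E p).source ∩ (chartAt E q).source := ht
  simpa only [extChartAt_source] using ht'

omit [IsManifold 𝓘(ℝ, E) ∞ X] in
/-- The derivative of the chart change is bijective on the overlap of the chart domains.
[folklore] -/
theorem bijective_tangentCoordChange [IsManifold 𝓘(ℝ, E) 1 X] {p q x : X}
    (hp : x ∈ (chartAt E p).source)
    (hq : x ∈ (chartAt E q).source) : Bijective (tangentCoordChange 𝓘(ℝ, E) p q x) := by
  have hp' : x ∈ (extChartAt 𝓘(ℝ, E) p).source := by rwa [extChartAt_source]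
  have hq' : x ∈ (extChartAt 𝓘(ℝ, E) q).source := by rwa [extChartAt_source]
  have h1 : ∀ v, tangentCoordChange 𝓘(ℝ, E) q p x (tangentCoordChange 𝓘(ℝ, E) p q x v) = v :=
    fun v => by rw [tangentCoordChange_comp ⟨⟨hp', hq'⟩, hp'⟩, tangentCoordChange_self hp']
  have h2 : ∀ v, tangentCoordChange 𝓘(ℝ, E) p q x (tangentCoordChange 𝓘(ℝ, E) q p x v) = v :=
    fun v => by rw [tangentCoordChange_comp ⟨⟨hq', hp'⟩, hq'⟩, tangentCoordChange_self hq']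
  exact (Equiv.mk _ _ h1 h2).bijective

end Curve

/-! ### Coherence of a smooth orientation along a connected piece of a chart domain -/

section Orientation

variable {E H : Type*} [NormedAddCommGroup E] [NormedSpace ℝ E] [TopologicalSpace H]
  {I : ModelWithCorners ℝ E H} {M : Type*} [TopologicalSpace M] [ChartedSpace H M]
  [IsManifold I 1 M]

/-- The sign of the Jacobian of the chart change `x₀ → p` is locally constant near `x₀`.
[folklore] -/
theorem eventually_det_tangentCoordChange_pos_iff {x₀ p : M} (h : x₀ ∈ (chartAt H p).source) :
    ∀ᶠ x in 𝓝 x₀, (0 < LinearMap.det ((tangentCoordChange I x₀ p x : E →L[ℝ] E) : E →ₗ[ℝ] E) ↔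
      0 < LinearMap.det ((tangentCoordChange I x₀ p x₀ : E →L[ℝ] E) : E →ₗ[ℝ] E)) := by
  have hmem : x₀ ∈ (extChartAt I x₀).source ∩ (extChartAt I p).source :=
    ⟨mem_extChartAt_source x₀, by rwa [extChartAt_source]⟩
  have hnhds : (extChartAt I x₀).source ∩ (extChartAt I p).source ∈ 𝓝 x₀ :=
    ((isOpen_extChartAt_source x₀).inter (isOpen_extChartAt_source p)).mem_nhds hmem
  have hc : ContinuousAt (fun x => detSign (tangentCoordChange I x₀ p x)) x₀ :=
    ((continuousOn_detSign_tangentCoordChange x₀ p) x₀ hmem).continuousAt hnhds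
  have hev : ∀ᶠ x in 𝓝 x₀, detSign (tangentCoordChange I x₀ p x) =
      detSign (tangentCoordChange I x₀ p x₀) :=
    hc.eventually (show ∀ᶠ y in 𝓝 (detSign (tangentCoordChange I x₀ p x₀)),
      y = detSign (tangentCoordChange I x₀ p x₀) by
        rw [nhds_discrete]; exact Filter.eventually_pure.2 rfl)
  filter_upwards [hev] with x hx
  rw [← detSign_eq_one_iff, ← detSign_eq_one_iff, hx]

/-- Propositional bookkeeping for the coherence lemma. [folklore] -/
theorem coherence_bookkeeping {P Q A a b b₀ c : Prop} (hdet : c ↔ (b ↔ a)) (htri : P ↔ (A ↔ Q))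
    (h1 : A ↔ a) (h2 : b ↔ b₀) : (P ↔ c) ↔ (Q ↔ b₀) := by
  tauto

/-- Propositional bookkeeping for the transfer lemma. [folklore] -/
theorem transfer_bookkeeping {Px Px' R g a c : Prop} (hmul : c ↔ (g ↔ a)) (h1 : Px ↔ a)
    (h2 : Px' ↔ c) (htri : R ↔ (Px' ↔ Px)) : g ↔ R := by
  tauto

/-- Multiplicativity of the Jacobian sign along the cocycle of chart changes at a point of a
triple overlap. [folklore] -/
theorem det_tangentCoordChange_pos_iff_of_mem {w x y z : M} (hw : z ∈ (extChartAt I w).source)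
    (hx : z ∈ (extChartAt I x).source) (hy : z ∈ (extChartAt I y).source) :
    0 < LinearMap.det ((tangentCoordChange I w y z : E →L[ℝ] E) : E →ₗ[ℝ] E) ↔
      (0 < LinearMap.det ((tangentCoordChange I x y z : E →L[ℝ] E) : E →ₗ[ℝ] E) ↔
        0 < LinearMap.det ((tangentCoordChange I w x z : E →L[ℝ] E) : E →ₗ[ℝ] E)) := by
  have hcoc := tangentCoordChange_comp_eq (I := I) ⟨⟨hw, hx⟩, hy⟩
  have h := congrArg (fun A : E →L[ℝ] E => LinearMap.det (A : E →ₗ[ℝ] E)) hcoc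
  simp only [ContinuousLinearMap.toLinearMap_comp, LinearMap.det_comp] at h
  rw [← h]
  exact mul_pos_iff_pos_iff_pos (det_tangentCoordChange_ne_zero ⟨hx, hy⟩)
    (det_tangentCoordChange_ne_zero ⟨hw, hx⟩)

/-- **Coherence of a smooth orientation on a connected piece of a chart domain.** The defining
local-constancy axiom of a smooth orientation `o` (near `x`, `o y = o x` iff the chart change
`y → x` has positive Jacobian at `y`) propagates to the whole connected component of `p` in the
chart domain of `p`: for every `x` there, `o x = o p` iff the chart change `x → p` has positive
Jacobian at `x` (clopen argument along the component).
[cite: HirschDT1976, Ch. 4 §4, para. preceding Lemma 4.1] -/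
theorem orientation_apply_eq_iff_of_mem_connectedComponentIn (o : SmoothOrientation I M)
    {p x : M} (hx : x ∈ connectedComponentIn (chartAt H p).source p) :
    o x = o p ↔ 0 < LinearMap.det ((tangentCoordChange I x p x : E →L[ℝ] E) : E →ₗ[ℝ] E) := by
  let S : Set M :=
    {x | o x = o p ↔ 0 < LinearMap.det ((tangentCoordChange I x p x : E →L[ℝ] E) : E →ₗ[ℝ] E)}
  -- local constancy of membership in `S` along the chart domain
  have key : ∀ x₀ ∈ (chartAt H p).source, ∀ᶠ x in 𝓝 x₀, (x ∈ S ↔ x₀ ∈ S) := by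
    intro x₀ hx₀
    filter_upwards [o.eventually_eq_iff x₀, eventually_det_tangentCoordChange_pos_iff (I := I) hx₀,
      (chartAt H p).open_source.mem_nhds hx₀, (chartAt H x₀).open_source.mem_nhds
      (mem_chart_source H x₀)] with x h1 h2 h3 h4
    have hxp : x ∈ (extChartAt I p).source := by rwa [extChartAt_source]
    have hxx₀ : x ∈ (extChartAt I x₀).source := by rwa [extChartAt_source]
    exact coherence_bookkeeping
      (det_tangentCoordChange_pos_iff_of_mem (mem_extChartAt_source x) hxx₀ hxp)
      (orientation_eq_iff_eq_iff_eq (o x) (o x₀) (o p)) h1 h2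
  -- `U ∩ S` and `U ∩ Sᶜ` are open
  have hopen : ∀ T : Set M, (∀ x₀ ∈ (chartAt H p).source, ∀ᶠ x in 𝓝 x₀, (x ∈ T ↔ x₀ ∈ T)) →
      IsOpen ((chartAt H p).source ∩ T) := by
    intro T hT
    rw [isOpen_iff_mem_nhds]
    rintro x₀ ⟨hx₀U, hx₀T⟩
    filter_upwards [(chartAt H p).open_source.mem_nhds hx₀U, hT x₀ hx₀U] with x hxU hx
    exact ⟨hxU, hx.2 hx₀T⟩
  have hS : IsOpen ((chartAt H p).source ∩ S) := hopen S key
  have hSc : IsOpen ((chartAt H p).source ∩ Sᶜ) := hopen Sᶜ fun x₀ hx₀ => by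
    filter_upwards [key x₀ hx₀] with x hx
    exact not_congr hx
  -- the component of `p` lies in `S`
  have hpS : p ∈ S := by
    show o p = o p ↔ 0 < LinearMap.det ((tangentCoordChange I p p p : E →L[ℝ] E) : E →ₗ[ℝ] E)
    rw [tangentCoordChange_self_eq (mem_extChartAt_source p), ContinuousLinearMap.coe_id,
      LinearMap.det_id]
    exact iff_of_true rfl zero_lt_one
  have hsub : connectedComponentIn (chartAt H p).source p ⊆ (chartAt H p).source ∩ S := by
    refine isPreconnected_connectedComponentIn.subset_left_of_subset_union hS hSc ?_ ?_ ?_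
    · exact Disjoint.mono_left inter_subset_right
        (Disjoint.mono_right inter_subset_right disjoint_compl_right)
    · intro x hx
      have hxU : x ∈ (chartAt H p).source := connectedComponentIn_subset _ _ hx
      by_cases h : x ∈ S
      · exact Or.inl ⟨hxU, h⟩
      · exact Or.inr ⟨hxU, h⟩
    · exact ⟨p, mem_connectedComponentIn (mem_chart_source H p), mem_chart_source H p, hpS⟩
  exact (hsub hx).2

/-- **Jacobian sign between two chart centres.** If `x` lies in the connected components of
`p` and `p'` in their chart domains, then the chart change `p → p'` has positive Jacobian at
`x` iff `o p' = o p`.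
[cite: HirschDT1976, Ch. 4 §4, para. preceding Lemma 4.1] -/
theorem orientation_det_tangentCoordChange_pos_iff (o : SmoothOrientation I M)
    {p p' x : M} (hx : x ∈ connectedComponentIn (chartAt H p).source p)
    (hx' : x ∈ connectedComponentIn (chartAt H p').source p') :
    0 < LinearMap.det ((tangentCoordChange I p p' x : E →L[ℝ] E) : E →ₗ[ℝ] E) ↔ o p' = o p := by
  have hxp : x ∈ (extChartAt I p).source := by
    rw [extChartAt_source]; exact connectedComponentIn_subset _ _ hx
  have hxp' : x ∈ (extChartAt I p').source := by
    rw [extChartAt_source]; exact connectedComponentIn_subset _ _ hx'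
  have htri : o p' = o p ↔ (o x = o p' ↔ o x = o p) := by
    rw [orientation_eq_iff_eq_iff_eq (o p') (o x) (o p)]
    constructor
    · rintro h
      exact ⟨fun h' => h.1 h'.symm, fun h' => (h.2 h').symm⟩
    · rintro h
      exact ⟨fun h' => h.1 h'.symm, fun h' => (h.2 h').symm⟩
  exact transfer_bookkeeping
    (det_tangentCoordChange_pos_iff_of_mem (mem_extChartAt_source x) hxp hxp')
    (orientation_apply_eq_iff_of_mem_connectedComponentIn o hx)
    (orientation_apply_eq_iff_of_mem_connectedComponentIn o hx') htri

end Orientation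


section Walk

variable {E : Type*} [NormedAddCommGroup E] [NormedSpace ℝ E]
  {F : Type*} [NormedAddCommGroup F] [NormedSpace ℝ F]
  {X : Type*} [TopologicalSpace X] [ChartedSpace E X] {γ : ℝ → X}

omit [NormedSpace ℝ E] in
/-- Points of the curve near a parameter stay in a chart domain. [folklore] -/
theorem exists_Ioo_subset_preimage_source (hγ : Continuous γ) {p : X} {t : ℝ}
    (h : γ t ∈ (chartAt E p).source) :
    ∃ ε > 0, Ioo (t - ε) (t + ε) ⊆ γ ⁻¹' (chartAt E p).source := by
  obtain ⟨ε, hε, hball⟩ := Metric.isOpen_iff.1 ((chartAt E p).open_source.preimage hγ) t h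
  exact ⟨ε, hε, fun u hu => hball (by rw [Metric.mem_ball, Real.dist_eq, abs_lt]; constructor <;>
    linarith [hu.1, hu.2])⟩

variable [IsManifold 𝓘(ℝ, E) ∞ X]

/-- Local notation: the derivative cocycle of the chart changes of `X`. -/
local notation "τ" => tangentCoordChange 𝓘(ℝ, E)

/-- **Chartwise smoothness of a frame field along a curve.** `Nf t : F →L[ℝ] E` is read in the
preferred chart at `γ t`; `SmoothFrameOn γ Nf s` says that, re-read in the chart at any `q`, the
field is smooth in `t` on the part of `s` where `γ t` lies in the chart domain of `q`. [folklore] -/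
def SmoothFrameOn (γ : ℝ → X) (Nf : ℝ → F →L[ℝ] E) (s : Set ℝ) : Prop :=
  ∀ q : X, ContDiffOn ℝ ∞ (fun t => (τ (γ t) q (γ t)).comp (Nf t)) (s ∩ γ ⁻¹' (chartAt E q).source)

/-- **Frames along a curve.** `FrameAt γ Nf t`: the field `Nf t` (read in the chart at `γ t`)
completes the velocity of `γ` at `t` (read in the same chart) to a frame. [folklore] -/
def FrameAt (γ : ℝ → X) (Nf : ℝ → F →L[ℝ] E) (t : ℝ) : Prop :=
  IsFrame (chartVec E γ (γ t) t) (Nf t)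

variable {Nf Nf' : ℝ → F →L[ℝ] E} {s s' : Set ℝ}

/-- Restriction of chartwise smoothness. [folklore] -/
theorem SmoothFrameOn.mono (h : SmoothFrameOn γ Nf s) (hst : s' ⊆ s) : SmoothFrameOn γ Nf s' :=
  fun q => (h q).mono (inter_subset_inter_left _ hst)

/-- Chartwise smoothness only depends on the values on `s`. [folklore] -/
theorem SmoothFrameOn.congr (h : SmoothFrameOn γ Nf s) (heq : ∀ t ∈ s, Nf' t = Nf t) :
    SmoothFrameOn γ Nf' s :=
  fun q => (h q).congr fun t ht => by simp only [heq t ht.1]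

/-- Chartwise smoothness on two open sets gives chartwise smoothness on their union. [folklore] -/
theorem SmoothFrameOn.union (hγ : Continuous γ) (h : SmoothFrameOn γ Nf s)
    (h' : SmoothFrameOn γ Nf s') (hs : IsOpen s) (hs' : IsOpen s') :
    SmoothFrameOn γ Nf (s ∪ s') := by
  intro q t ht
  have hq : IsOpen (γ ⁻¹' (chartAt E q).source) := (chartAt E q).open_source.preimage hγ
  rcases ht.1 with h1 | h1
  · exact ((h q).contDiffAt ((hs.inter hq).mem_nhds ⟨h1, ht.2⟩)).contDiffWithinAt
  · exact ((h' q).contDiffAt ((hs'.inter hq).mem_nhds ⟨h1, ht.2⟩)).contDiffWithinAt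

omit [IsManifold 𝓘(ℝ, E) ∞ X] in
/-- `FrameAt` only depends on the value `Nf t`. [folklore] -/
theorem frameAt_congr {t : ℝ} (heq : Nf' t = Nf t) : FrameAt γ Nf' t ↔ FrameAt γ Nf t := by
  unfold FrameAt; rw [heq]

/-- Changing the reference chart of a constant representation (cocycle). [folklore] -/
theorem rep_change {p p' x : X} (hp' : x ∈ (chartAt E p').source) (hp : x ∈ (chartAt E p).source)
    (M : F →L[ℝ] E) : (τ p' x x).comp M = (τ p x x).comp ((τ p' p x).comp M) := by
  rw [← ContinuousLinearMap.comp_assoc, tangentCoordChange_comp_eq]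
  exact ⟨⟨by rwa [extChartAt_source], by rwa [extChartAt_source]⟩, mem_extChartAt_source x⟩

/-- **Representation lemma.** A field represented on an open `s` as `Nf t = τ p (γ t) (γ t) ∘ N t`
with `N` smooth on `s` (plain smoothness, coordinates of the chart at `p`) is chartwise smooth
on `s`. [folklore] -/
theorem smoothFrameOn_of_eq (hγ : ContMDiff 𝓘(ℝ, ℝ) 𝓘(ℝ, E) ∞ γ) {p : X}
    (hsp : s ⊆ γ ⁻¹' (chartAt E p).source) {N : ℝ → F →L[ℝ] E} (hN : ContDiffOn ℝ ∞ N s)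
    (heq : ∀ t ∈ s, Nf t = (τ p (γ t) (γ t)).comp (N t)) : SmoothFrameOn γ Nf s := by
  intro q
  have h1 : ContDiffOn ℝ ∞ (fun t => (τ p q (γ t)).comp (N t)) (s ∩ γ ⁻¹' (chartAt E q).source) :=
    ((contDiffOn_tangentCoordChange_comp hγ p q).mono fun t ht => ⟨hsp ht.1, ht.2⟩).clm_comp
      (hN.mono inter_subset_left)
  refine h1.congr fun t ht => ?_
  have hp : γ t ∈ (extChartAt 𝓘(ℝ, E) p).source := by rw [extChartAt_source]; exact hsp ht.1
  have hq : γ t ∈ (extChartAt 𝓘(ℝ, E) q).source := by rw [extChartAt_source]; exact ht.2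
  simp only [heq t ht.1]
  rw [← ContinuousLinearMap.comp_assoc,
    tangentCoordChange_comp_eq ⟨⟨hp, mem_extChartAt_source _⟩, hq⟩]

/-- **Validity transfer.** If `Nf t = τ p (γ t) (γ t) ∘ N`, then `Nf t` completes the velocity read
in the chart at `γ t` iff `N` completes the velocity read in the chart at `p`. [folklore] -/
theorem frameAt_iff_of_eq (hγ : ContMDiff 𝓘(ℝ, ℝ) 𝓘(ℝ, E) ∞ γ) {p : X} {t : ℝ}
    (hp : γ t ∈ (chartAt E p).source) {N : F →L[ℝ] E} (heq : Nf t = (τ p (γ t) (γ t)).comp N) :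
    FrameAt γ Nf t ↔ IsFrame (chartVec E γ p t) N := by
  unfold FrameAt
  rw [heq, chartVec_eq_tangentCoordChange hγ hp (mem_chart_source E (γ t))]
  exact isFrame_map_iff (bijective_tangentCoordChange hp (mem_chart_source E (γ t)))

/-- The incoming germ of the next segment is a frame at the frontier. [folklore] -/
theorem isFrame_germ (hγ : ContMDiff 𝓘(ℝ, ℝ) 𝓘(ℝ, E) ∞ γ) {p p' : X} {t : ℝ}
    (hp' : γ t ∈ (chartAt E p').source) (hp : γ t ∈ (chartAt E p).source) {M : F →L[ℝ] E}
    (heq : Nf t = (τ p' (γ t) (γ t)).comp M) (hv : FrameAt γ Nf t) :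
    IsFrame (chartVec E γ p t) ((τ p' p (γ t)).comp M) :=
  (frameAt_iff_of_eq hγ hp (by rw [heq, rep_change hp' hp])).1 hv

variable [FiniteDimensional ℝ E] [FiniteDimensional ℝ F]

/-- **The segment step of the walk.** Given the invariant at the frontier `b` (chartwise
smoothness on `(-ε, b + ε)`, frames on `[0, b]`, a constant representation `τ p' · · ∘ M` near
`b`), a new chart centre `p` whose domain contains `γ [b, b']`, a constant `M'` completing the
chart-`p` velocities on `[b, b']`, and a smooth path of frames of the chart-`p` velocity at `b`
from the incoming germ `τ p' p (γ b) ∘ M` to `M'`, the invariant is re-established at the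
frontier `b'`, without changing the field on `(-∞, b]` nor near `0`. [folklore] -/
theorem walk_step (hγ : ContMDiff 𝓘(ℝ, ℝ) 𝓘(ℝ, E) ∞ γ) {b b' ε : ℝ} {p' p : X}
    {M M' : F →L[ℝ] E} {π : ℝ → F →L[ℝ] E} (hb : 0 ≤ b) (hbb' : b < b') (hε : 0 < ε)
    (hsm : SmoothFrameOn γ Nf (Ioo (-ε) (b + ε))) (hval : ∀ t ∈ Icc 0 b, FrameAt γ Nf t)
    (hfr : ∀ t ∈ Ioo (b - ε) (b + ε),
      γ t ∈ (chartAt E p').source ∧ Nf t = (τ p' (γ t) (γ t)).comp M)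
    (hp : ∀ t ∈ Icc b b', γ t ∈ (chartAt E p).source)
    (hM' : ∀ t ∈ Icc b b', IsFrame (chartVec E γ p t) M') (hπ : ContDiff ℝ ∞ π)
    (hπ0 : π 0 = (τ p' p (γ b)).comp M) (hπ1 : π 1 = M')
    (hπv : ∀ s ∈ Icc (0 : ℝ) 1, IsFrame (chartVec E γ p b) (π s)) :
    ∃ (Nf' : ℝ → F →L[ℝ] E) (ε' : ℝ), 0 < ε' ∧ ε' ≤ ε ∧
      SmoothFrameOn γ Nf' (Ioo (-ε') (b' + ε')) ∧ (∀ t ∈ Icc 0 b', FrameAt γ Nf' t) ∧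
      (∀ t ≤ b, Nf' t = Nf t) ∧ (∀ t ∈ Ioo (-ε') ε', Nf' t = Nf t) ∧
      (∀ t ∈ Ioo (b' - ε') (b' + ε'),
        γ t ∈ (chartAt E p).source ∧ Nf' t = (τ p (γ t) (γ t)).comp M') := by
  have hγc : Continuous γ := hγ.continuous
  -- the window of the germ
  set U : Set ℝ := Ioo (b - ε) (b + ε) ∩ γ ⁻¹' ((chartAt E p').source ∩ (chartAt E p).source)
    with hU
  have hUo : IsOpen U :=
    isOpen_Ioo.inter (((chartAt E p').open_source.inter (chartAt E p).open_source).preimage hγc)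
  have hbε : b ∈ Ioo (b - ε) (b + ε) := ⟨by linarith, by linarith⟩
  have hbU : b ∈ U := ⟨hbε, (hfr b hbε).1, hp b ⟨le_rfl, hbb'.le⟩⟩
  -- the germ, the velocity
  set Ñ : ℝ → F →L[ℝ] E := fun t => (τ p' p (γ t)).comp M with hÑ
  have hÑs : ContDiffOn ℝ ∞ Ñ U :=
    ((contDiffOn_tangentCoordChange_comp hγ p' p).mono inter_subset_right).clm_comp contDiffOn_const
  have hT : ContinuousAt (chartVec E γ p) b :=
    (continuousOn_chartVec hγ p).continuousAt
      (((chartAt E p).open_source.preimage hγc).mem_nhds (hp b ⟨le_rfl, hbb'.le⟩))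
  obtain ⟨N, δ, hδ, hδb', hIcc, hNs, hNl, hNr, hNv⟩ :=
    exists_splice (Ñ := Ñ) hUo hbU hbb' hT hÑs hπ hπ0 hπv
  -- validity of `N` on `[b, b']`
  have hNv' : ∀ t ∈ Icc b b', IsFrame (chartVec E γ p t) (N t) := fun t ht => by
    by_cases h : t ≤ b + δ
    · exact hNv t ⟨ht.1, h⟩
    · rw [hNr t (le_of_lt (not_le.1 h)), hπ1]
      exact hM' t ht
  -- room beyond `b'`
  obtain ⟨ε₂, hε₂, hε₂sub⟩ :=
    exists_Ioo_subset_preimage_source (E := E) hγc (hp b' ⟨hbb'.le, le_rfl⟩)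
  -- the key identity on the left part of the window
  have hKI : ∀ t ∈ U, t ≤ b + δ / 4 → (τ p (γ t) (γ t)).comp (N t) = Nf t := by
    intro t htU ht
    rw [hNl t ht, (hfr t htU.1).2, hÑ]
    exact (rep_change htU.2.1 htU.2.2 M).symm
  -- the new field
  set Nf' : ℝ → F →L[ℝ] E := fun t => if t ≤ b then Nf t else (τ p (γ t) (γ t)).comp (N t) with hNf'
  set ε' : ℝ := min (min ε ε₂) (min (δ / 4) (b' - b - δ)) with hε'
  have hε'pos : 0 < ε' := lt_min (lt_min hε hε₂) (lt_min (by linarith) (by linarith))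
  have hε'ε : ε' ≤ ε := (min_le_left _ _).trans (min_le_left _ _)
  have hε'ε₂ : ε' ≤ ε₂ := (min_le_left _ _).trans (min_le_right _ _)
  have hε'δ : ε' ≤ δ / 4 := (min_le_right _ _).trans (min_le_left _ _)
  have hε'b : ε' ≤ b' - b - δ := (min_le_right _ _).trans (min_le_right _ _)
  -- values of the new field
  have hle : ∀ t ≤ b, Nf' t = Nf t := fun t ht => by simp only [hNf', if_pos ht]
  have hgt : ∀ t, b < t → Nf' t = (τ p (γ t) (γ t)).comp (N t) := fun t ht => by
    simp only [hNf', if_neg (not_le.2 ht)]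
  have hwin : ∀ t ∈ Icc (b - δ) (b + δ / 4), Nf' t = Nf t := fun t ht => by
    by_cases h : t ≤ b
    · exact hle t h
    · rw [hgt t (not_le.1 h)]
      exact hKI t (hIcc ⟨ht.1, by linarith [ht.2]⟩) ht.2
  have hwin' : ∀ t ∈ Ioo (b - δ) (b' + ε'), Nf' t = (τ p (γ t) (γ t)).comp (N t) := fun t ht => by
    by_cases h : t ≤ b
    · rw [hle t h]
      exact (hKI t (hIcc ⟨ht.1.le, by linarith⟩) (by linarith)).symm
    · exact hgt t (not_le.1 h)
  refine ⟨Nf', ε', hε'pos, hε'ε, ?_, ?_, hle, ?_, ?_⟩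
  · -- chartwise smoothness
    have h1 : SmoothFrameOn γ Nf' (Ioo (-ε) (b + ε')) :=
      (hsm.mono (Ioo_subset_Ioo_right (by linarith))).congr fun t ht => by
        by_cases h : t ≤ b
        · exact hle t h
        · exact hwin t ⟨by linarith [not_le.1 h], by linarith [ht.2]⟩
    have h2 : SmoothFrameOn γ Nf' (Ioo (b - δ) (b' + ε')) := by
      refine smoothFrameOn_of_eq hγ (p := p) (fun t ht => ?_) (N := N)
        (hNs.mono fun t ht => ?_) hwin'
      · show γ t ∈ (chartAt E p).source
        rcases le_or_gt t b with h | h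
        · exact (hIcc ⟨ht.1.le, by linarith⟩).2.2
        · rcases le_or_gt t b' with h' | h'
          · exact hp t ⟨h.le, h'⟩
          · exact hε₂sub ⟨by linarith, by linarith [ht.2]⟩
      · rcases le_or_gt t b with h | h
        · exact Or.inl (hIcc ⟨ht.1.le, by linarith⟩)
        · exact Or.inr h
    refine ((h1.union hγc h2 isOpen_Ioo isOpen_Ioo).mono fun t ht => ?_)
    rcases lt_or_ge t (b + ε') with h | h
    · exact Or.inl ⟨by linarith [ht.1], h⟩
    · exact Or.inr ⟨by linarith, ht.2⟩
  · -- frames on `[0, b']`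
    intro t ht
    by_cases h : t ≤ b
    · exact (frameAt_congr (hle t h)).2 (hval t ⟨ht.1, h⟩)
    · have h' : b < t := not_le.1 h
      exact (frameAt_iff_of_eq hγ (hp t ⟨h'.le, ht.2⟩) (hgt t h')).2 (hNv' t ⟨h'.le, ht.2⟩)
  · -- unchanged near `0`
    intro t ht
    by_cases h : t ≤ b
    · exact hle t h
    · exact hwin t ⟨by linarith [not_le.1 h], by linarith [ht.2]⟩
  · -- the new frontier
    intro t ht
    have h1 : b + δ ≤ t := by linarith [ht.1]
    refine ⟨hε₂sub ⟨by linarith [ht.1], by linarith [ht.2]⟩, ?_⟩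
    rw [hgt t (by linarith), hNr t h1, hπ1]

end Walk

/-! ### The walk over `[0, 1]` -/

section WalkInner

variable {E : Type*} [NormedAddCommGroup E] [InnerProductSpace ℝ E] [FiniteDimensional ℝ E]
  {F : Type*} [NormedAddCommGroup F] [NormedSpace ℝ F] [FiniteDimensional ℝ F]
  {X : Type*} [TopologicalSpace X] [ChartedSpace E X] [IsManifold 𝓘(ℝ, E) ∞ X] {γ : ℝ → X}

/-- Local notation: the derivative cocycle of the chart changes of `X`. -/
local notation "τ" => tangentCoordChange 𝓘(ℝ, E)

/-- **The walk invariant** at the frontier `b`: a field `Nf`, chartwise smooth on `(-ε, b + ε)`,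
consisting of frames on `[0, b]`, equal to the constant `M₀` read from the chart at `p₀` near
`0`, and to a constant read from some chart near `b`. [folklore] -/
def WalkInv (γ : ℝ → X) (p₀ : X) (M₀ : F →L[ℝ] E) (b : ℝ) : Prop :=
  ∃ (Nf : ℝ → F →L[ℝ] E) (ε : ℝ) (p : X) (M : F →L[ℝ] E), 0 < ε ∧
    SmoothFrameOn γ Nf (Ioo (-ε) (b + ε)) ∧ (∀ t ∈ Icc 0 b, FrameAt γ Nf t) ∧
    (∀ t ∈ Ioo (-ε) ε, Nf t = (τ p₀ (γ t) (γ t)).comp M₀) ∧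
    (∀ t ∈ Ioo (b - ε) (b + ε), γ t ∈ (chartAt E p).source ∧ Nf t = (τ p (γ t) (γ t)).comp M)

/-- A vector not in the range of `N` ... existence of a frame completing a nonzero vector: the
orthogonal complement of `T` has the dimension of `F`. [folklore] -/
theorem exists_isFrame (hdim : Module.finrank ℝ E = Module.finrank ℝ F + 1) {T : E} (hT : T ≠ 0) :
    ∃ N : F →L[ℝ] E, IsFrame T N := by
  haveI : Fact (Module.finrank ℝ E = Module.finrank ℝ F + 1) := ⟨hdim⟩
  have hK : Module.finrank ℝ (ℝ ∙ T)ᗮ = Module.finrank ℝ F :=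
    Submodule.finrank_orthogonal_span_singleton hT
  let e : F ≃L[ℝ] (ℝ ∙ T)ᗮ := ContinuousLinearEquiv.ofFinrankEq hK.symm
  refine ⟨(Submodule.subtypeL _).comp (e : F →L[ℝ] (ℝ ∙ T)ᗮ), ?_⟩
  refine isFrame_of_inner_eq_zero hdim (S := T) ?_ (fun w => ?_) ?_
  · exact Subtype.val_injective.comp e.injective
  · have hmem : ((e w : (ℝ ∙ T)ᗮ) : E) ∈ (ℝ ∙ T)ᗮ := (e w).2
    rw [Submodule.mem_orthogonal_singleton_iff_inner_right] at hmem
    exact hmem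
  · exact inner_self_ne_zero.2 hT

omit [FiniteDimensional ℝ E] [FiniteDimensional ℝ F] in
/-- **The start of the walk**: the invariant at the frontier `0`, with the constant field
`τ p₀ (γ t) (γ t) ∘ M₀`. [folklore] -/
theorem walkInv_zero (hγ : ContMDiff 𝓘(ℝ, ℝ) 𝓘(ℝ, E) ∞ γ) {p₀ : X}
    (hp₀ : γ 0 ∈ (chartAt E p₀).source)
    {M₀ : F →L[ℝ] E} (hM₀ : IsFrame (chartVec E γ p₀ 0) M₀) : WalkInv γ p₀ M₀ 0 := by
  obtain ⟨ε, hε, hsub⟩ := exists_Ioo_subset_preimage_source (E := E) hγ.continuous hp₀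
  rw [zero_sub, zero_add] at hsub
  refine ⟨fun t => (τ p₀ (γ t) (γ t)).comp M₀, ε, p₀, M₀, hε, ?_, ?_, fun t _ => rfl, ?_⟩
  · rw [zero_add]
    exact smoothFrameOn_of_eq hγ hsub contDiffOn_const fun t _ => rfl
  · intro t ht
    obtain rfl : t = 0 := le_antisymm ht.2 ht.1
    exact (frameAt_iff_of_eq hγ hp₀ rfl).2 hM₀
  · rw [zero_sub, zero_add]
    exact fun t ht => ⟨hsub ht, rfl⟩

/-- **The walk.** Along a smooth curve `γ` with nonvanishing chart velocities, a frame `M₀` of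
the velocity at `0` (read in a chart at `p₀ ∋ γ 0`) extends to a chartwise smooth frame field
over a neighbourhood of `[0, 1]` which is constant (in some chart) near `1`: Lebesgue number of
the cover of `[0, 1]` by the parameter sets where `γ` stays in the chart at `γ s` with velocity
at a positive angle from the velocity at `s`, then finitely many segment steps, each moving the
incoming frame to the shear-projection onto the orthogonal complement of the reference velocity.
[cite: HirschDT1976, Ch. 4 §4, Exercise 2 (p. 108)] -/
theorem exists_walkInv_one (hγ : ContMDiff 𝓘(ℝ, ℝ) 𝓘(ℝ, E) ∞ γ)
    (hdim : Module.finrank ℝ E = Module.finrank ℝ F + 1) (hreg : ∀ t, chartVec E γ (γ t) t ≠ 0)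
    {p₀ : X} (hp₀ : γ 0 ∈ (chartAt E p₀).source) {M₀ : F →L[ℝ] E}
    (hM₀ : IsFrame (chartVec E γ p₀ 0) M₀) : WalkInv γ p₀ M₀ 1 := by
  have hγc : Continuous γ := hγ.continuous
  -- the cover of `[0, 1]` and its Lebesgue number
  let W : ℝ → Set ℝ := fun s =>
    γ ⁻¹' (chartAt E (γ s)).source ∩
      (fun t => ⟪chartVec E γ (γ s) t, chartVec E γ (γ s) s⟫) ⁻¹' Ioi 0
  have hWo : ∀ s, IsOpen (W s) := fun s =>
    ((continuousOn_chartVec hγ (γ s)).inner continuousOn_const).isOpen_inter_preimage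
      ((chartAt E (γ s)).open_source.preimage hγc) isOpen_Ioi
  have hWs : ∀ s, s ∈ W s := fun s =>
    ⟨mem_chart_source E (γ s), real_inner_self_pos.2 (hreg s)⟩
  obtain ⟨δ, hδ, hLeb⟩ := lebesgue_number_lemma_of_metric isCompact_Icc hWo
    (fun t (_ : t ∈ Icc (0 : ℝ) 1) => mem_iUnion.2 ⟨t, hWs t⟩)
  -- induction on the number of steps of length `δ / 2`
  have key : ∀ k : ℕ, WalkInv γ p₀ M₀ (min (k * (δ / 2)) 1) := by
    intro k
    induction k with
    | zero => simpa using walkInv_zero hγ hp₀ hM₀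
    | succ k ih =>
      by_cases hk : 1 ≤ (k : ℝ) * (δ / 2)
      · have h1 : min ((k : ℝ) * (δ / 2)) 1 = 1 := min_eq_right hk
        have h2 : min (((k + 1 : ℕ) : ℝ) * (δ / 2)) 1 = 1 :=
          min_eq_right (hk.trans (by push_cast; nlinarith))
        rw [h2]; rwa [h1] at ih
      · set b : ℝ := (k : ℝ) * (δ / 2) with hb_def
        have hb0 : 0 ≤ b := by positivity
        have hb1 : b < 1 := not_le.1 hk
        have h1 : min b 1 = b := min_eq_left hb1.le
        rw [h1] at ih
        set b' : ℝ := min (b + δ / 2) 1 with hb'_def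
        have h2 : min (((k + 1 : ℕ) : ℝ) * (δ / 2)) 1 = b' := by
          rw [hb'_def, hb_def]; push_cast; ring_nf
        rw [h2]
        have hbb' : b < b' := lt_min (by linarith) hb1
        have hb'b : b' ≤ b + δ / 2 := min_le_left _ _
        -- the chart of the new segment
        obtain ⟨s, hs⟩ := hLeb b ⟨hb0, hb1.le⟩
        have hseg : ∀ t ∈ Icc b b', t ∈ W s := fun t ht =>
          hs (by rw [Metric.mem_ball, Real.dist_eq, abs_lt]; constructor <;> linarith [ht.1, ht.2])
        obtain ⟨Nf, ε, p', M, hε, hsm, hval, h0, hfr⟩ := ih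
        set p : X := γ s with hp_def
        set S : E := chartVec E γ p s with hS_def
        have hp : ∀ t ∈ Icc b b', γ t ∈ (chartAt E p).source := fun t ht => (hseg t ht).1
        have hpos : ∀ t ∈ Icc b b', 0 < ⟪chartVec E γ p t, S⟫ := fun t ht => (hseg t ht).2
        -- the incoming germ at `b` and the target constant
        have hbε : b ∈ Ioo (b - ε) (b + ε) := ⟨by linarith, by linarith⟩
        have hG : IsFrame (chartVec E γ p b) ((τ p' p (γ b)).comp M) :=
          isFrame_germ hγ (hfr b hbε).1 (hp b ⟨le_rfl, hbb'.le⟩) (hfr b hbε).2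
            (hval b ⟨hb0, le_rfl⟩)
        set G : F →L[ℝ] E := (τ p' p (γ b)).comp M with hG_def
        set M' : F →L[ℝ] E := shearProj S (chartVec E γ p b) G with hM'_def
        have hST : ⟪S, chartVec E γ p b⟫ ≠ 0 := by
          rw [real_inner_comm]; exact (hpos b ⟨le_rfl, hbb'.le⟩).ne'
        have hM' : ∀ t ∈ Icc b b', IsFrame (chartVec E γ p t) M' := fun t ht =>
          isFrame_shearProj_of_inner_ne_zero hdim hG hST
            (by rw [real_inner_comm]; exact (hpos t ht).ne')
        -- the path from the germ to the target
        set π : ℝ → F →L[ℝ] E := fun r => (1 - stepFun 0 1 r) • G + stepFun 0 1 r • M' with hπ_def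
        have hπ : ContDiff ℝ ∞ π :=
          ((contDiff_const.sub (contDiff_stepFun 0 1)).smul contDiff_const).add
            ((contDiff_stepFun 0 1).smul contDiff_const)
        have hπ0 : π 0 = G := by
          simp only [hπ_def, stepFun_of_le zero_lt_one le_rfl]; simp
        have hπ1 : π 1 = M' := by
          simp only [hπ_def, stepFun_of_ge zero_lt_one le_rfl]; simp
        have hπv : ∀ r ∈ Icc (0 : ℝ) 1, IsFrame (chartVec E γ p b) (π r) := fun r _ =>
          isFrame_convexComb_shearProj hG _
        obtain ⟨Nf', ε', hε', hε'ε, hsm', hval', -, h0', hfr'⟩ :=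
          walk_step hγ hb0 hbb' hε hsm hval hfr hp hM' hπ hπ0 hπ1 hπv
        refine ⟨Nf', ε', p, M', hε', hsm', hval', fun t ht => ?_, hfr'⟩
        rw [h0' t ht]
        exact h0 t ⟨by linarith [ht.1], by linarith [ht.2]⟩
  -- enough steps
  obtain ⟨k, hk⟩ := exists_nat_ge (2 / δ)
  have hk' : 1 ≤ (k : ℝ) * (δ / 2) := by
    rw [div_le_iff₀ hδ] at hk
    linarith
  simpa [min_eq_right hk'] using key k

end WalkInner

end Literature.Topology.FourManifolds.CircleFraming
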